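import Mathlib

/-!
# `JLPairIdentityOne`: integrability of the two literal integrands
(support of stmt-KontsevichZagierPeriods-14654, route IsogenyCertificates)

Real-variable half of the existence of the item's two representations: Molina's sextic
`f_X = −x(9x+4)(4x+1)(172x³+176x²+60x+7)` (`X₀³⁵/⟨ω₅⟩`) satisfies `f_X ≥ 2(x+1/4)(−x) > 0` on the oval
`(−1/4, 0)`, and the sextic `f_C = (u²+4)(u+1)(u³−5u²+3u−19)` (`X₀(35)/⟨w₇⟩`) satisfies
`f_C ≥ 112·(−1−u)` on `(−2,−1)` and `f_C ≥ u⁶/2` on `(−∞,−2]`; hence `dx/√f_X` is integrable on the oval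
(two inverse-square-root endpoint singularities) and `(−10−6u)du/√f_C` on `(−∞,−1)` (one such singularity and
an `O(u⁻²)` tail, by reflection to `(2,∞)`). The representations themselves are built in
`IsogenyCertificatesJLPairIdentityOneReps`.

References: M. Kontsevich, D. Zagier, *Periods* (2001), §1.1; S. Molina (2012), Table 2
[cite: Molina2012, Table 2]; J. González (1991) [cite: Gonzalez1991, §4].
-/

noncomputable section

open Set MeasureTheory

namespace Summit.KontsevichZagierPeriods.IsogenyCertificates.JLPairIdentityOneIntegrability

/-! ### Polynomial inequalities -/

/-- Molina's sextic `f_X(x) = −x(9x+4)(4x+1)(172x³+176x²+60x+7)`. [cite: Molina2012, Table 2] -/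
theorem fX_lower {x : ℝ} (h1 : -1 / 4 < x) (h2 : x < 0) :
    2 * ((x + 1 / 4) * -x) ≤ -x * (9 * x + 4) * (4 * x + 1) * (172 * x ^ 3 + 176 * x ^ 2 + 60 * x
        + 7) := by
  -- 172x³+176x²+60x+7 = 5/16 + (x + 1/4)(172x² + 133x + 107/4) ≥ 5/16 on x ≥ −1/4; 9x + 4 ≥ 7/4
  have hq : 0 < 172 * x ^ 2 + 133 * x + 107 / 4 := by nlinarith [sq_nonneg (x + 133 / 344)]
  have hc : 5 / 16 ≤ 172 * x ^ 3 + 176 * x ^ 2 + 60 * x + 7 := by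
    nlinarith [mul_nonneg (show (0:ℝ) ≤ x + 1 / 4 by linarith) hq.le]
  have hA : (1 : ℝ) / 2 ≤ (9 * x + 4) * (172 * x ^ 3 + 176 * x ^ 2 + 60 * x + 7) := by
    have h74 : (7 : ℝ) / 4 ≤ 9 * x + 4 := by linarith
    nlinarith [mul_le_mul h74 hc (by norm_num) (by linarith)]
  have hB : 0 ≤ -x * (4 * x + 1) := mul_nonneg (by linarith) (by linarith)
  have key : -x * (9 * x + 4) * (4 * x + 1) * (172 * x ^ 3 + 176 * x ^ 2 + 60 * x + 7)
      = (-x * (4 * x + 1)) * ((9 * x + 4) * (172 * x ^ 3 + 176 * x ^ 2 + 60 * x + 7)) := by ring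
  rw [key]
  nlinarith [mul_le_mul_of_nonneg_left hA hB]

/-- `f_X > 0` on the big oval `(−1/4, 0)`. [cite: Molina2012, Table 2] -/
theorem fX_pos {x : ℝ} (h1 : -1 / 4 < x) (h2 : x < 0) :
    0 < -x * (9 * x + 4) * (4 * x + 1) * (172 * x ^ 3 + 176 * x ^ 2 + 60 * x + 7) :=
  lt_of_lt_of_le (by nlinarith) (fX_lower h1 h2)

/-- Near the branch point: `f_C(u) ≥ 112·(−1−u)` for `−2 < u < −1`. [cite: Gonzalez1991, §4] -/
theorem fC_lower_near {u : ℝ} (h1 : -2 < u) (h2 : u < -1) :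
    112 * (-1 - u) ≤ (u ^ 2 + 4) * (u + 1) * (u ^ 3 - 5 * u ^ 2 + 3 * u - 19) := by
  have ha : 4 ≤ u ^ 2 + 4 := by nlinarith
  have hm : 1 ≤ -u := by linarith
  have h3 : 1 ≤ (-u) ^ 3 := one_le_pow₀ hm
  have hb : 28 ≤ -(u ^ 3 - 5 * u ^ 2 + 3 * u - 19) := by nlinarith [h3, hm]
  have hc : 0 ≤ -1 - u := by linarith
  have key : (u ^ 2 + 4) * (u + 1) * (u ^ 3 - 5 * u ^ 2 + 3 * u - 19)
      = (u ^ 2 + 4) * (-(u ^ 3 - 5 * u ^ 2 + 3 * u - 19)) * (-1 - u) := by ring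
  rw [key]
  have h4 : (4 : ℝ) * 28 ≤ (u ^ 2 + 4) * (-(u ^ 3 - 5 * u ^ 2 + 3 * u - 19)) :=
    mul_le_mul ha hb (by norm_num) (by linarith)
  nlinarith [mul_le_mul_of_nonneg_right h4 hc]

/-- The tail: `f_C(u) ≥ u⁶/2` for `u ≤ −2`. [cite: Gonzalez1991, §4] -/
theorem fC_lower_tail {u : ℝ} (h : u ≤ -2) :
    u ^ 6 / 2 ≤ (u ^ 2 + 4) * (u + 1) * (u ^ 3 - 5 * u ^ 2 + 3 * u - 19) := by
  have ha : u ^ 2 ≤ u ^ 2 + 4 := by linarith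
  have hb : -u ^ 3 ≤ -(u ^ 3 - 5 * u ^ 2 + 3 * u - 19) := by nlinarith [sq_nonneg u]
  have hb0 : 0 ≤ -u ^ 3 := by nlinarith [sq_nonneg u]
  have hc : -u / 2 ≤ -1 - u := by linarith
  have hc0 : 0 ≤ -u / 2 := by linarith
  have key : (u ^ 2 + 4) * (u + 1) * (u ^ 3 - 5 * u ^ 2 + 3 * u - 19)
      = (u ^ 2 + 4) * (-(u ^ 3 - 5 * u ^ 2 + 3 * u - 19)) * (-1 - u) := by ring
  rw [key]
  have h1 : u ^ 2 * -u ^ 3 ≤ (u ^ 2 + 4) * (-(u ^ 3 - 5 * u ^ 2 + 3 * u - 19)) :=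
    mul_le_mul ha hb hb0 (by nlinarith)
  have h2 : u ^ 2 * -u ^ 3 * (-u / 2) ≤ (u ^ 2 + 4) * (-(u ^ 3 - 5 * u ^ 2 + 3 * u - 19)) * (-1 -
      u) :=
    mul_le_mul h1 hc hc0 (le_trans (mul_nonneg (sq_nonneg u) hb0) h1)
  nlinarith [h2]

/-- `f_C > 0` on `(−∞, −1)`. [cite: Gonzalez1991, §4] -/
theorem fC_pos {u : ℝ} (h : u < -1) :
    0 < (u ^ 2 + 4) * (u + 1) * (u ^ 3 - 5 * u ^ 2 + 3 * u - 19) := by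
  rcases lt_or_ge (-2) u with h2 | h2
  · exact lt_of_lt_of_le (by nlinarith) (fC_lower_near h2 h)
  · have hm : 2 ≤ -u := by linarith
    have h64 : (2 : ℝ) ^ 6 ≤ (-u) ^ 6 := pow_le_pow_left₀ (by norm_num) hm 6
    have h6 : (-u) ^ 6 = u ^ 6 := by ring
    exact lt_of_lt_of_le (by nlinarith) (fC_lower_tail h2)

/-- `1/√(pq) ≤ (1/√p + 1/√q)/√(p+q)` for `p, q > 0` (since `√p + √q ≥ √(p+q)`). [folklore] -/
theorem inv_sqrt_mul_le_div {p q : ℝ} (hp : 0 < p) (hq : 0 < q) :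
    1 / Real.sqrt (p * q) ≤ (1 / Real.sqrt p + 1 / Real.sqrt q) / Real.sqrt (p + q) := by
  have hsp : 0 < Real.sqrt p := Real.sqrt_pos.2 hp
  have hsq : 0 < Real.sqrt q := Real.sqrt_pos.2 hq
  have hs : 0 < Real.sqrt (p + q) := Real.sqrt_pos.2 (by linarith)
  have hsum : Real.sqrt (p + q) ≤ Real.sqrt p + Real.sqrt q := by
    rw [Real.sqrt_le_left (by positivity)]
    nlinarith [Real.sq_sqrt hp.le, Real.sq_sqrt hq.le, mul_pos hsp hsq]
  rw [Real.sqrt_mul hp.le, div_add_div _ _ hsp.ne' hsq.ne', one_mul, mul_one, div_div,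
    div_le_div_iff₀ (mul_pos hsp hsq) (by positivity), one_mul]
  calc Real.sqrt p * Real.sqrt q * Real.sqrt (p + q)
      ≤ Real.sqrt p * Real.sqrt q * (Real.sqrt p + Real.sqrt q) :=
        mul_le_mul_of_nonneg_left hsum (mul_pos hsp hsq).le
    _ = (Real.sqrt q + Real.sqrt p) * (Real.sqrt p * Real.sqrt q) := by ring

/-! ### Integrability on `ℝ` -/

/-- `dx/√f_X` is integrable on the oval `(−1/4, 0)` (domination by `2(x+1/4)^{−1/2} +
2(−x)^{−1/2}`).
[cite: KontsevichZagier2001, §1.1] -/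
theorem integrableOn_X :
    IntegrableOn (fun x : ℝ =>
      1 / Real.sqrt (-x * (9 * x + 4) * (4 * x + 1) * (172 * x ^ 3 + 176 * x ^ 2 + 60 * x + 7)))
      (Ioo (-1 / 4 : ℝ) 0) := by
  have hmeas : Measurable fun x : ℝ =>
      1 / Real.sqrt (-x * (9 * x + 4) * (4 * x + 1) * (172 * x ^ 3 + 176 * x ^ 2 + 60 * x + 7)) :=
          by
    fun_prop
  have hr : IntervalIntegrable (fun x : ℝ => x ^ (-(1 / 2 : ℝ))) volume 0 1 :=
    intervalIntegral.intervalIntegrable_rpow' (by norm_num)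
  have hle : (-1 / 4 : ℝ) ≤ 0 := by norm_num
  have hg1 : IntegrableOn (fun x : ℝ => (x + 1 / 4) ^ (-(1 / 2 : ℝ))) (Ioo (-1 / 4 : ℝ) 0) := by
    have h2 : IntervalIntegrable (fun x : ℝ => (x + 1 / 4) ^ (-(1 / 2 : ℝ))) volume
        (-1 / 4) (3 / 4) := by
      convert hr.comp_add_right (1 / 4) using 2 <;> norm_num
    have h3 : IntervalIntegrable (fun x : ℝ => (x + 1 / 4) ^ (-(1 / 2 : ℝ))) volume
        (-1 / 4) 0 :=
      h2.mono_set (by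
        rw [Set.uIcc_of_le hle, Set.uIcc_of_le (by norm_num)]
        exact Set.Icc_subset_Icc le_rfl (by norm_num))
    exact (intervalIntegrable_iff_integrableOn_Ioo_of_le hle).mp h3
  have hg2 : IntegrableOn (fun x : ℝ => (-x) ^ (-(1 / 2 : ℝ))) (Ioo (-1 / 4 : ℝ) 0) := by
    have h2 : IntervalIntegrable (fun x : ℝ => (-x) ^ (-(1 / 2 : ℝ))) volume (-1) 0 := by
      convert (hr.comp_mul_left (c := -1)).symm using 2 <;> norm_num
    have h3 : IntervalIntegrable (fun x : ℝ => (-x) ^ (-(1 / 2 : ℝ))) volume (-1 / 4) 0 :=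
      h2.mono_set (by
        rw [Set.uIcc_of_le hle, Set.uIcc_of_le (by norm_num)]
        exact Set.Icc_subset_Icc (by norm_num) le_rfl)
    exact (intervalIntegrable_iff_integrableOn_Ioo_of_le hle).mp h3
  refine Integrable.mono' ((hg1.add hg2).const_mul 2) hmeas.aestronglyMeasurable ?_
  filter_upwards [ae_restrict_mem measurableSet_Ioo] with x hx
  rw [Real.norm_eq_abs, abs_of_nonneg (div_nonneg zero_le_one (Real.sqrt_nonneg _)), Pi.add_apply]
  have hp : 0 < x + 1 / 4 := by linarith [hx.1]
  have hq : 0 < -x := by linarith [hx.2]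
  rw [Real.rpow_neg hp.le, Real.rpow_neg hq.le, ← Real.sqrt_eq_rpow, ← Real.sqrt_eq_rpow, ←
      one_div, ← one_div]
  have hF := fX_lower hx.1 hx.2
  have hpq : 0 < (x + 1 / 4) * -x := mul_pos hp hq
  have h14 : Real.sqrt ((x + 1 / 4) + -x) = 1 / 2 := by
    rw [show (x + 1 / 4) + -x = (1 / 2 : ℝ) ^ 2 by ring, Real.sqrt_sq (by norm_num)]
  calc 1 / Real.sqrt (-x * (9 * x + 4) * (4 * x + 1) * (172 * x ^ 3 + 176 * x ^ 2 + 60 * x + 7))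
      ≤ 1 / Real.sqrt ((x + 1 / 4) * -x) :=
        one_div_le_one_div_of_le (Real.sqrt_pos.2 hpq) (Real.sqrt_le_sqrt (by nlinarith))
    _ ≤ (1 / Real.sqrt (x + 1 / 4) + 1 / Real.sqrt (-x)) / Real.sqrt ((x + 1 / 4) + -x) :=
        inv_sqrt_mul_le_div hp hq
    _ = 2 * (1 / Real.sqrt (x + 1 / 4) + 1 / Real.sqrt (-x)) := by rw [h14]; ring

/-- `(−10−6u)du/√f_C` is integrable on `(−2, −1)` (domination by `(−1−u)^{−1/2}`).
[cite: KontsevichZagier2001, §1.1] -/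
theorem integrableOn_C_near :
    IntegrableOn (fun u : ℝ =>
      (-10 - 6 * u) / Real.sqrt ((u ^ 2 + 4) * (u + 1) * (u ^ 3 - 5 * u ^ 2 + 3 * u - 19))) (Ioo
          (-2 : ℝ) (-1)) := by
  have hmeas : Measurable fun u : ℝ =>
      (-10 - 6 * u) / Real.sqrt ((u ^ 2 + 4) * (u + 1) * (u ^ 3 - 5 * u ^ 2 + 3 * u - 19)) := by
          fun_prop
  have hr : IntervalIntegrable (fun x : ℝ => x ^ (-(1 / 2 : ℝ))) volume 0 1 :=
    intervalIntegral.intervalIntegrable_rpow' (by norm_num)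
  have hle : (-2 : ℝ) ≤ -1 := by norm_num
  have hg : IntegrableOn (fun u : ℝ => (-1 * u + -1) ^ (-(1 / 2 : ℝ))) (Ioo (-2 : ℝ) (-1)) :=
      by
    have h3 : IntervalIntegrable (fun u : ℝ => (-1 * u + -1) ^ (-(1 / 2 : ℝ))) volume
        (-2) (-1) := by
      have h2 := ((hr.comp_add_right (-1)).comp_mul_left (c := -1)).symm
      convert h2 using 2 <;> norm_num
    exact (intervalIntegrable_iff_integrableOn_Ioo_of_le hle).mp h3
  refine Integrable.mono' hg hmeas.aestronglyMeasurable ?_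
  filter_upwards [ae_restrict_mem measurableSet_Ioo] with u hu
  have hv : 0 < -1 - u := by linarith [hu.2]
  have hF := fC_lower_near hu.1 hu.2
  have hFpos : 0 < (u ^ 2 + 4) * (u + 1) * (u ^ 3 - 5 * u ^ 2 + 3 * u - 19) := lt_of_lt_of_le (by
      linarith) hF
  rw [Real.norm_eq_abs, abs_div, show -1 * u + -1 = -1 - u by ring, Real.rpow_neg hv.le, ←
      Real.sqrt_eq_rpow,
    abs_of_pos (Real.sqrt_pos.2 hFpos), div_le_iff₀ (Real.sqrt_pos.2 hFpos), ← one_div]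
  have hnum : |-10 - 6 * u| ≤ 4 := by rw [abs_le]; constructor <;> linarith [hu.1, hu.2]
  have hs : Real.sqrt (112 * (-1 - u)) ≤ Real.sqrt ((u ^ 2 + 4) * (u + 1) * (u ^ 3 - 5 * u ^ 2 + 3
      * u - 19)) :=
    Real.sqrt_le_sqrt hF
  have h112 : Real.sqrt (112 * (-1 - u)) = Real.sqrt 112 * Real.sqrt (-1 - u) := Real.sqrt_mul (by
      norm_num) _
  have h10 : (10 : ℝ) ≤ Real.sqrt 112 := by
    rw [show (10 : ℝ) = Real.sqrt (10 ^ 2) from (Real.sqrt_sq (by norm_num)).symm]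
    exact Real.sqrt_le_sqrt (by norm_num)
  have hsv : 0 < Real.sqrt (-1 - u) := Real.sqrt_pos.2 hv
  calc |-10 - 6 * u| ≤ 4 := hnum
    _ ≤ Real.sqrt 112 := by linarith
    _ = 1 / Real.sqrt (-1 - u) * (Real.sqrt 112 * Real.sqrt (-1 - u)) := by
        field_simp
    _ ≤ 1 / Real.sqrt (-1 - u) * Real.sqrt ((u ^ 2 + 4) * (u + 1) * (u ^ 3 - 5 * u ^ 2 + 3 * u -
        19)) := by
        rw [← h112]; exact mul_le_mul_of_nonneg_left hs (by positivity)

/-- `(−10−6u)du/√f_C` is integrable on `(−∞, −2)` (reflection `u ↦ −u` and domination by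
`16·t^{−2}` on `(2, ∞)`).
[cite: KontsevichZagier2001, §1.1] -/
theorem integrableOn_C_tail :
    IntegrableOn (fun u : ℝ =>
      (-10 - 6 * u) / Real.sqrt ((u ^ 2 + 4) * (u + 1) * (u ^ 3 - 5 * u ^ 2 + 3 * u - 19))) (Iio
          (-2 : ℝ)) := by
  set G : ℝ → ℝ := fun u => (-10 - 6 * u) / Real.sqrt ((u ^ 2 + 4) * (u + 1) * (u ^ 3 - 5 * u ^ 2
      + 3 * u - 19))
  have hmp : MeasurePreserving (Neg.neg : ℝ → ℝ) volume volume := Measure.measurePreserving_neg _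
  have hpre : (Neg.neg : ℝ → ℝ) ⁻¹' (Ioi (2 : ℝ)) = Iio (-2) := by
    ext u; simp only [mem_preimage, mem_Ioi, mem_Iio]; constructor <;> intro h <;> linarith
  have hH : IntegrableOn (fun t : ℝ => G (-t)) (Ioi (2 : ℝ)) := by
    have hmeas : Measurable fun t : ℝ => G (-t) := by simp only [G]; fun_prop
    have hg : IntegrableOn (fun t : ℝ => 16 * t ^ (-(2 : ℝ))) (Ioi (2 : ℝ)) :=
      (integrableOn_Ioi_rpow_of_lt (by norm_num) two_pos).const_mul 16
    refine Integrable.mono' hg hmeas.aestronglyMeasurable ?_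
    filter_upwards [ae_restrict_mem measurableSet_Ioi] with t ht
    have ht2 : (2 : ℝ) < t := ht
    have ht0 : 0 < t := by linarith
    have hF := fC_lower_tail (show -t ≤ -2 by linarith)
    have hFpos : 0 < ((-t) ^ 2 + 4) * (-t + 1) * ((-t) ^ 3 - 5 * (-t) ^ 2 + 3 * (-t) - 19) :=
      lt_of_lt_of_le (by rw [show (-t) ^ 6 / 2 = t ^ 6 / 2 by ring]; positivity) hF
    simp only [G]
    rw [Real.norm_eq_abs, abs_div, abs_of_pos (Real.sqrt_pos.2 hFpos), div_le_iff₀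
        (Real.sqrt_pos.2 hFpos),
      Real.rpow_neg ht0.le, Real.rpow_two]
    have hnum : |-10 - 6 * -t| ≤ 11 * t := by rw [abs_le]; constructor <;> linarith
    have hs : Real.sqrt ((-t) ^ 6 / 2) ≤
        Real.sqrt (((-t) ^ 2 + 4) * (-t + 1) * ((-t) ^ 3 - 5 * (-t) ^ 2 + 3 * (-t) - 19)) :=
            Real.sqrt_le_sqrt hF
    have h6 : Real.sqrt ((-t) ^ 6 / 2) = t ^ 3 / Real.sqrt 2 := by
      rw [show (-t) ^ 6 / 2 = (t ^ 3) ^ 2 / 2 by ring, Real.sqrt_div (sq_nonneg _), Real.sqrt_sq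
          (by positivity)]
    have hs2 : Real.sqrt 2 ≤ 16 / 11 := by
      rw [Real.sqrt_le_left (by norm_num)]; norm_num
    have hs2pos : 0 < Real.sqrt 2 := Real.sqrt_pos.2 two_pos
    have h11 : 11 * t * Real.sqrt 2 ≤ 16 * t := by
      nlinarith [mul_le_mul_of_nonneg_left hs2 (show (0:ℝ) ≤ 11 * t by positivity)]
    calc |-10 - 6 * -t| ≤ 11 * t := hnum
      _ ≤ 16 * t / Real.sqrt 2 := by rw [le_div_iff₀ hs2pos]; exact h11
      _ = 16 * (t ^ 2)⁻¹ * (t ^ 3 / Real.sqrt 2) := by field_simp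
      _ ≤ 16 * (t ^ 2)⁻¹ * Real.sqrt (((-t) ^ 2 + 4) * (-t + 1) * ((-t) ^ 3 - 5 * (-t) ^ 2 + 3 *
          (-t) - 19)) := by
          rw [← h6]; exact mul_le_mul_of_nonneg_left hs (by positivity)
  have h := (hmp.integrableOn_comp_preimage (MeasurableEquiv.neg ℝ).measurableEmbedding).mpr hH
  rw [hpre] at h
  refine h.congr_fun (fun u _ => ?_) measurableSet_Iio
  simp only [Function.comp_apply, neg_neg]

/-- `(−10−6u)du/√f_C` is integrable on `(−∞, −1)`. [cite: KontsevichZagier2001, §1.1] -/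
theorem integrableOn_C :
    IntegrableOn (fun u : ℝ =>
      (-10 - 6 * u) / Real.sqrt ((u ^ 2 + 4) * (u + 1) * (u ^ 3 - 5 * u ^ 2 + 3 * u - 19))) (Iio
          (-1 : ℝ)) := by
  rw [← Iic_union_Ioo_eq_Iio (show (-2 : ℝ) < -1 by norm_num)]
  exact (Iff.mpr integrableOn_Iic_iff_integrableOn_Iio integrableOn_C_tail).union
      integrableOn_C_near

end Summit.KontsevichZagierPeriods.IsogenyCertificates.JLPairIdentityOneIntegrability

end
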